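import Literature.NumberTheory.Automorphic.PairLFunctionPolesRepDataRealisation
import Literature.NumberTheory.Automorphic.AutomorphicRepsGLCuspidalUnitaryHolds
import Literature.NumberTheory.Automorphic.PairLFunctionPolesGLOneDedekindProofs
import HarnessLib

/-!
# Arthur–Clozel (2.1)–(2.3) for Borel–Jacquet data: the dictionary leaves DISCHARGED (proofs only)

Topic `NumberTheory/Automorphic`; namespace `Literature.NumberTheory.Automorphic`. Proof file
(theorems only: no definition, no named fact, no instance, no `sorry`), sibling of
`PairLFunctionPolesRepData` (the named facts `JacquetShalika1981_multipliable_partialPairL_repData`,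
`…_partialPairL_boundary_repData`, `…_partialPairL_pole_repData`: Arthur–Clozel, *Simple algebras,
base change, and the advanced theory of the trace formula*, Ann. of Math. Stud. 120 (1989), Ch. 3 §2,
(2.1)–(2.3), p. 171 of the held copy, stated in the Borel–Jacquet model
`CuspidalAutomorphicRepData`), `PairLFunctionPolesRepDataProofs` and
`PairLFunctionPolesRepDataRealisation`.

`PairLFunctionPolesRepDataRealisation` puts the three facts on the base
`{cuspidal_closure_exists_mem_l2OfForms, stable_cuspidal_eq_sSup_irreducible}` plus their `L²` forms
(`…_of_closure_leaves`). Both dictionary leaves are now theorems of the tree: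

* `AutomorphicRepsGL.cuspidal_closure_exists_mem_l2OfForms_holds` and its corollary
  `AutomorphicRepsGL.exists_le_formsOfL2_of_W'_eq_bot_holds` (`AutomorphicRepsGLIrreducibleL2HCHolds`:
  an irreducible stable space of `A_G`-invariant cusp forms on `GL_n(𝔸_K)` lies in some irreducible
  closed invariant `Π ≤ L²_cusp`; Borel–Jacquet 1979, 4.6, Harish-Chandra 1953, Thm. 5);
* `AutomorphicRepsGL.stable_cuspidal_eq_sSup_irreducible_holds` (`AutomorphicRepsGLCuspidalUnitaryHolds`:
  semisimplicity of the space of `A_G`-invariant cusp forms; Borel–Jacquet 1979, 4.6).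

Consequently:

* **(2.1) is a theorem**: `JacquetShalika1981_multipliable_partialPairL_repData_holds` — the Euler
  product `L^S(s, π ⊗ σ)` of two cuspidal Borel–Jacquet data with unitary Satake families is
  multipliable for `Re s > 1` (its `L²` form being the theorem
  `JacquetShalika1981_multipliable_partialPairL_holds`, Jacquet–Shalika I, Thm. (5.3), from the bound
  `|t_{π,w}| ≤ q_w^{1/2}`);
* **(2.3) hangs on one leaf**: `JacquetShalika1981_partialPairL_pole_repData_of_pole_of_eq_conj` — the
  fact `JacquetShalika1981_partialPairL_pole_repData` follows from its `L²` form
  `JacquetShalika1981_partialPairL_pole_of_eq_conj` (Jacquet–Shalika II, Prop. 3.6: the simple pole of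
  `L^S(s, π ⊗ π̃)` at `s = 1`) **alone**;
* **(2.2) hangs on its four `L²` leaves**: `JacquetShalika1981_partialPairL_boundary_repData_of_L2_leaves`
  (`…_at_one_of_ne_conj`, `…_boundary_of_ne_one`, `…_at_one_of_rank_ne`, `multiplicity_one_gl`).
* **(2.3) rank by rank, and rank one unconditionally**: the reduction uses the `L²` leaf only in the
  rank (and over the field) of the data at hand, so `JacquetShalika1981_partialPairL_pole_repData_rank`
  gives the rank-`n` case of the fact from `JacquetShalika1981_partialPairL_pole_of_eq_conj` in
  rank `n` over the same field (all automorphic measures); in rank `1` that leaf is the theorem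
  `JacquetShalika1981_partialPairL_pole_of_eq_conj_one` (`PairLFunctionPolesGLOneDedekindProofs`: the
  simple pole of `ζ_F^S` at `1`, Hecke), whence the **theorem**
  `JacquetShalika1981_partialPairL_pole_repData_one` — (2.3) for pairs of cuspidal Borel–Jacquet data
  on `GL_1(𝔸_F)` (Hecke characters of the idele classes), the case consumed by `HeckeCharacterPairRigidity`.

## References

* J. Arthur, L. Clozel, *Simple algebras, base change, and the advanced theory of the trace
  formula*, Ann. of Math. Stud. 120 (1989), Ch. 3 §2, (2.1)–(2.3), p. 171. [ArthurClozelAMS120]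
* H. Jacquet, J. A. Shalika, *On Euler products and the classification of automorphic
  representations I*, Amer. J. Math. 103 (1981), 499–558, Thm. (5.3). [JacquetShalikaAJM1981]
* H. Jacquet, J. A. Shalika, *On Euler products and the classification of automorphic forms II*,
  Amer. J. Math. 103 (1981), 777–815, Prop. 3.6, Thm. 4.4. [JacquetShalikaAJM1981II]
* A. Borel, H. Jacquet, *Automorphic forms and automorphic representations*, Proc. Sympos. Pure
  Math. 33 (1979), part 1, 4.6, 5.7. [BorelJacquetCorvallis1979]
-/

noncomputable section

open scoped MatrixGroups Topology Classical
open NumberField IsDedekindDomain MeasureTheory Filter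

namespace Literature.NumberTheory.Automorphic

open AdelicGroupData

/-- **Arthur–Clozel (2.1) for Borel–Jacquet data, DISCHARGED.** For cuspidal automorphic
representations `π` of `GL_n(𝔸_F)` and `σ` of `GL_m(𝔸_F)` (Borel–Jacquet data) and `S ⊇ S₀` finite,
the Euler product `L^S(s, π ⊗ σ)` over unitary Satake families is multipliable for `Re s > 1`
("The Euler product `L^S` is absolutely convergent for `Re s > 1`"): the reduction
`JacquetShalika1981_multipliable_partialPairL_repData_of_closure_leaves` fed with the theorems
`AutomorphicRepsGL.cuspidal_closure_exists_mem_l2OfForms_holds` and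
`AutomorphicRepsGL.stable_cuspidal_eq_sSup_irreducible_holds`.
[cite: ArthurClozelAMS120, Ch. 3 §2 (2.1), p. 171] [cite: JacquetShalikaAJM1981, Thm. (5.3)] -/
theorem JacquetShalika1981_multipliable_partialPairL_repData_holds :
    JacquetShalika1981_multipliable_partialPairL_repData :=
  JacquetShalika1981_multipliable_partialPairL_repData_of_closure_leaves
    (fun _ _ _ => AutomorphicRepsGL.cuspidal_closure_exists_mem_l2OfForms_holds)
    (fun _ => AutomorphicRepsGL.stable_cuspidal_eq_sSup_irreducible_holds)

/-- **Arthur–Clozel (2.3) for Borel–Jacquet data from its `L²` form alone.** The fact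
`JacquetShalika1981_partialPairL_pole_repData` (for cuspidal `π`, `σ` on `GL_n(𝔸_F)`, `S ⊇ S₀`, unitary
Satake families and `s₀ ∈ X`, "the limit `lim_{s → s₀} (s - s₀) L^S(s, π ⊗ σ)` exists and is finite
and non-zero") follows from `JacquetShalika1981_partialPairL_pole_of_eq_conj` (the simple pole of
`L^S(s, π ⊗ π̃)` at `s = 1` for cuspidal `π ≤ L²_cusp`, Jacquet–Shalika II, Prop. 3.6), granted for all
`GL_n` over all number fields and all automorphic measures: the reduction
`JacquetShalika1981_partialPairL_pole_repData_of_closure_leaves` with the dictionary leaves supplied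
by `AutomorphicRepsGL.cuspidal_closure_exists_mem_l2OfForms_holds` and
`AutomorphicRepsGL.stable_cuspidal_eq_sSup_irreducible_holds`.
[cite: ArthurClozelAMS120, Ch. 3 §2 (2.3), p. 171] [cite: JacquetShalikaAJM1981II, Prop. 3.6] -/
theorem JacquetShalika1981_partialPairL_pole_repData_of_pole_of_eq_conj
    (h23 : ∀ {n : ℕ} {K : Type} [Field K] [NumberField K] {μ : Measure (gl n K).automorphicQuotient}
      [(gl n K).IsAutomorphicMeasure μ],
      JacquetShalika1981_partialPairL_pole_of_eq_conj (n := n) (K := K) (μ := μ)) :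
    JacquetShalika1981_partialPairL_pole_repData :=
  JacquetShalika1981_partialPairL_pole_repData_of_closure_leaves h23
    (fun _ _ _ => AutomorphicRepsGL.cuspidal_closure_exists_mem_l2OfForms_holds)
    (fun _ => AutomorphicRepsGL.stable_cuspidal_eq_sSup_irreducible_holds)

/-- **Arthur–Clozel (2.2) for Borel–Jacquet data from its four `L²` leaves.** The fact
`JacquetShalika1981_partialPairL_boundary_repData` follows from the `L²` facts
`JacquetShalika1981_partialPairL_at_one_of_ne_conj`, `…_boundary_of_ne_one`, `…_at_one_of_rank_ne`
(Jacquet–Shalika II, Prop. 3.6 off `X`; non-vanishing on `Re s = 1`: Shahidi) and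
`multiplicity_one_gl`, the dictionary leaves of
`JacquetShalika1981_partialPairL_boundary_repData_of_closure_leaves` being theorems.
[cite: ArthurClozelAMS120, Ch. 3 §2 (2.2), p. 171] [cite: JacquetShalikaAJM1981II, Prop. 3.6 and Thm. 4.4] -/
theorem JacquetShalika1981_partialPairL_boundary_repData_of_L2_leaves
    (h22 : ∀ {n : ℕ} {K : Type} [Field K] [NumberField K] {μ : Measure (gl n K).automorphicQuotient}
      [(gl n K).IsAutomorphicMeasure μ],
      JacquetShalika1981_partialPairL_at_one_of_ne_conj (n := n) (K := K) (μ := μ))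
    (h22' : ∀ {n m : ℕ} {K : Type} [Field K] [NumberField K]
      {μ : Measure (gl n K).automorphicQuotient} [(gl n K).IsAutomorphicMeasure μ]
      {μ' : Measure (gl m K).automorphicQuotient} [(gl m K).IsAutomorphicMeasure μ'],
      JacquetShalika1981_partialPairL_boundary_of_ne_one (n := n) (m := m) (K := K) (μ := μ)
        (μ' := μ'))
    (hrk : ∀ {n m : ℕ} {K : Type} [Field K] [NumberField K]
      {μ : Measure (gl n K).automorphicQuotient} [(gl n K).IsAutomorphicMeasure μ]
      {μ' : Measure (gl m K).automorphicQuotient} [(gl m K).IsAutomorphicMeasure μ'],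
      JacquetShalika1981_partialPairL_at_one_of_rank_ne (n := n) (m := m) (K := K) (μ := μ)
        (μ' := μ'))
    (hm1 : ∀ (n : ℕ) (K : Type) [Field K] [NumberField K] (μ : Measure (gl n K).automorphicQuotient)
      [(gl n K).IsAutomorphicMeasure μ], multiplicity_one_gl n K μ) :
    JacquetShalika1981_partialPairL_boundary_repData :=
  JacquetShalika1981_partialPairL_boundary_repData_of_closure_leaves h22 h22' hrk hm1
    (fun _ _ _ => AutomorphicRepsGL.cuspidal_closure_exists_mem_l2OfForms_holds)
    (fun _ => AutomorphicRepsGL.stable_cuspidal_eq_sSup_irreducible_holds)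

/-! ### (2.3) rank by rank; rank one unconditionally -/

section RankWise

/-- **Arthur–Clozel (2.3) for Borel–Jacquet data in rank `n`, from (2.3) in `L²` in rank `n`.** For
cuspidal `π`, `σ` on `GL_n(𝔸_F)` (`n ≥ 1`, data `CuspidalAutomorphicRepData`): granted the `L²` form
`JacquetShalika1981_partialPairL_pole_of_eq_conj` (the simple pole of `L^S(s, Π ⊗ Π̃)` at `s = 1` for
cuspidal `Π ≤ L²_cusp(GL_n(F) A_G \ GL_n(𝔸_F))`, Jacquet–Shalika II, Prop. 3.6) **in this rank `n`
and over this field `F` only** (every automorphic measure), there is a finite `S₀` such that for every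
finite `S ⊇ S₀`, all unitary Satake families `α`, `β` of `π`, `σ` off `S` and every `s₀ ∈ X`
(`Re s₀ = 1`, `q_w^{1-s₀} t_{π,w} = t_{σ,w}⁻¹` for almost all `w`), "the limit
`lim_{s → s₀, Re s > 1} (s - s₀) L^S(s, π ⊗ σ)` exists and is finite and non-zero" — the rank-`n`
case of `JacquetShalika1981_partialPairL_pole_repData`. The proof is that of
`JacquetShalika1981_partialPairL_pole_repData_of_normalisation` verbatim (unitary normalisation
`t_{π,w} = q_w^{s} t_{Π,w}`, Borel–Jacquet 1979, 5.7, here unconditional: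
`CuspidalAutomorphicRepData.exists_satake_eq_cpow_mul_L2_of_le_formsOfL2` fed with the discharges
`AutomorphicRepsGL.exists_le_formsOfL2_of_W'_eq_bot_holds`, `AutomorphicRepsGL.stable_cuspidal_eq_sSup_irreducible_holds`;
direct shift off `T = S ∪ E`; change of `S` through the strict bound `norm_lt_sqrt_of_pole_of_eq_conj`
and (5.1.3) `norm_satakeParameter_le_sqrt_holds`), which invokes the `L²` leaf at `(n, F, μ)` alone.
[cite: ArthurClozelAMS120, Ch. 3 §2 (2.3), p. 171] [cite: JacquetShalikaAJM1981II, Prop. 3.6]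
[cite: JacquetShalikaAJM1981, (5.1) p. 554 and Cor. (2.5)] -/
theorem JacquetShalika1981_partialPairL_pole_repData_rank
    {n : ℕ} {F : Type} [Field F] [NumberField F]
    (h23 : ∀ (μ : Measure (gl n F).automorphicQuotient) [(gl n F).IsAutomorphicMeasure μ],
      JacquetShalika1981_partialPairL_pole_of_eq_conj (n := n) (K := F) (μ := μ))
    (hF : isCompact_glFiniteIntegralLevel n F) (hn : 0 < n)
    (π π' : CuspidalAutomorphicRepData n F hF) :
    ∃ S₀ : Set (HeightOneSpectrum (𝓞 F)), S₀.Finite ∧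
      ∀ {S : Set (HeightOneSpectrum (𝓞 F))} (_hS : S.Finite) (_hS₀ : S₀ ⊆ S)
        {α β : SatakeFamily F} (_hα : ∀ w ∉ S, π.1.HasSatakeParamAt w (α w))
        (_hβ : ∀ w ∉ S, π'.1.HasSatakeParamAt w (β w))
        (_hu : ∀ w ∉ S, ‖(α w).prod‖ = 1) (_hu' : ∀ w ∉ S, ‖(β w).prod‖ = 1)
        {s₀ : ℂ} (_hs₀ : s₀.re = 1)
        (_hX : ∀ᶠ w in cofinite,
          (α w).map (((w.residueCard : ℂ) ^ (1 - s₀)) * ·) = (β w).map (·⁻¹)),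
        ∃ c : ℂ, c ≠ 0 ∧
          Tendsto (fun s => (s - s₀) * partialPairL S α β s) (𝓝[{s : ℂ | 1 < s.re}] s₀) (𝓝 c) := by
  haveI : NeZero n := ⟨hn.ne'⟩
  haveI := infinite_heightOneSpectrum F
  obtain ⟨μ, hμ⟩ := AdelicGroupData.exists_isAutomorphicMeasure_gl_holds n F
  haveI := hμ
  have h23μ : JacquetShalika1981_partialPairL_pole_of_eq_conj (n := n) (K := F) (μ := μ) := h23 μ
  -- unitary normalisation of each datum (Borel–Jacquet 5.7), from the discharged dictionary leaves
  have hN : ∀ ϖ : CuspidalAutomorphicRepData n F hF,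
      ∃ (s : ℂ) (P : CuspidalAutomorphicRepGL n F μ) (S : Set (HeightOneSpectrum (𝓞 F)))
        (αP : SatakeFamily F), S.Finite ∧ IsSatakeFamilyOf P S αP ∧
        ∀ w ∉ S, ∀ β : Multiset ℂ,
          ϖ.1.HasSatakeParamAt w β ↔ β = (αP w).map (((w.residueCard : ℂ) ^ s) * ·) := by
    intro ϖ
    obtain ⟨ϖ₀, h0W', h0ϖ⟩ :=
      CuspidalAutomorphicRepData.exists_clean_hasSatakeParamAt_of_sSup_irreducible
        AutomorphicRepsGL.stable_cuspidal_eq_sSup_irreducible_holds ϖ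
    exact CuspidalAutomorphicRepData.exists_satake_eq_cpow_mul_L2_of_le_formsOfL2
      AutomorphicRepsGL.exists_le_formsOfL2_of_W'_eq_bot_holds ϖ ϖ₀ h0W' h0ϖ
  obtain ⟨s₁, s₂, P, P', S₀, αP, αP', hS₀, hαP, hαP', hiff, hiff'⟩ :=
    CuspidalAutomorphicRepData.exists_pair_satake_eq_cpow_mul_of_normalisation (hN π) (hN π')
  refine ⟨S₀, hS₀, ?_⟩
  intro S hS hS₀S α β hα hβ hu hu' s₀ hs₀ hX
  have hαe := eq_map_cpow_mul_of_hasSatakeParamAt hS₀S hiff hα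
  have hβe := eq_map_cpow_mul_of_hasSatakeParamAt hS₀S hiff' hβ
  obtain ⟨w₀, hw₀⟩ := hS.infinite_compl.nonempty
  have hs₁ : s₁.re = 0 :=
    re_eq_zero_of_norm_prod_eq_one_of_shift (hαP.mono hS₀S) hn hw₀ (hαe w₀ hw₀) (hu w₀ hw₀)
  have hs₂ : s₂.re = 0 :=
    re_eq_zero_of_norm_prod_eq_one_of_shift (hαP'.mono hS₀S) hn hw₀ (hβe w₀ hw₀) (hu' w₀ hw₀)
  have hz : (s₁ + s₂).re = 0 := by rw [Complex.add_re, hs₁, hs₂, add_zero]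
  -- the finite exceptional set of `s₀ ∈ X`, and the relation off `T = S ∪ E` in `L²` terms
  set E : Set (HeightOneSpectrum (𝓞 F)) :=
    {w | ¬ ((α w).map (((w.residueCard : ℂ) ^ (1 - s₀)) * ·) = (β w).map (·⁻¹))} with hE
  have hEfin : E.Finite := Filter.eventually_cofinite.1 hX
  set T : Set (HeightOneSpectrum (𝓞 F)) := S ∪ E with hT
  have hTfin : T.Finite := hS.union hEfin
  have hST : S ⊆ T := Set.subset_union_left
  have hS₀T : S₀ ⊆ T := hS₀S.trans hST
  set u : ℂ := 1 - s₀ + (s₁ + s₂) with hudef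
  have hu0 : u.re = 0 := by
    rw [hudef, Complex.add_re, Complex.sub_re, Complex.one_re, hs₀, hz, sub_self, add_zero]
  have hrel : ∀ w ∉ T,
      (αP w).map (((w.residueCard : ℂ) ^ u) * ·) = (αP' w).map (starRingEnd ℂ) := by
    intro w hw
    have hwS : w ∉ S := fun h => hw (hST h)
    have hwE : (α w).map (((w.residueCard : ℂ) ^ (1 - s₀)) * ·) = (β w).map (·⁻¹) := by
      by_contra h
      exact hw (Or.inr h)
    have hq : w.residueCard ≠ 0 := by have := w.one_lt_residueCard; omega
    rw [hαe w hwS, hβe w hwS, map_cpow_mul_map_cpow_mul_eq_map_inv_map_cpow_mul_iff hq,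
      (hαP'.mono hS₀S).map_inv_eq_map_conj hwS] at hwE
    exact hwE
  -- off `T`: `t_π = q^{s₁} t_{π₀}` and `t_σ = q^{s₂ - u} \bar t_{π₀}`
  have hαT : ∀ w ∉ T, α w = (αP w).map (((w.residueCard : ℂ) ^ s₁) * ·) :=
    fun w hw => hαe w (fun h => hw (hST h))
  have hγ : IsSatakeFamilyOf P.conj S₀ fun w => (αP w).map (starRingEnd ℂ) := hαP.conj
  have hβT : ∀ w ∉ T, β w =
      ((fun w => (αP w).map (starRingEnd ℂ)) w).map (((w.residueCard : ℂ) ^ (s₂ - u)) * ·) := by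
    intro w hw
    have hwS : w ∉ S := fun h => hw (hST h)
    have hq' : (w.residueCard : ℂ) ≠ 0 := by
      exact_mod_cast (zero_lt_one.trans w.one_lt_residueCard).ne'
    have h1 : αP' w = ((αP w).map (((w.residueCard : ℂ) ^ u) * ·)).map (starRingEnd ℂ) := by
      rw [hrel w hw, Multiset.map_map, Function.comp_def]
      simp only [Complex.conj_conj, Multiset.map_id']
    rw [hβe w hwS, h1]
    simp only [Multiset.map_map, Function.comp_def, map_mul]
    refine Multiset.map_congr rfl fun a _ => ?_
    rw [conj_natCast_cpow_of_re_eq_zero hu0, ← mul_assoc, ← Complex.cpow_add _ _ hq',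
      ← sub_eq_add_neg]
  -- the pole of `L^T(·, π₀ ⊗ π̄₀)` at `1` ((2.3) in `L²`, rank `n`) is a pole of `L^T(·, π ⊗ σ)` at `s₀`
  have hz' : (s₁ + (s₂ - u)).re = 0 := by
    rw [Complex.add_re, Complex.sub_re, hs₁, hs₂, hu0]
    ring
  have hs₀' : s₀ - (s₁ + (s₂ - u)) = 1 := by
    rw [hudef]
    ring
  obtain ⟨c, hc, hlim⟩ :=
    h23μ hn P P.conj P.conj_conj.symm hTfin (hαP.mono hS₀T) (hγ.mono hS₀T)
  have hTlim : Tendsto (fun s => (s - s₀) * partialPairL T α β s) (𝓝[{s : ℂ | 1 < s.re}] s₀)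
      (𝓝 c) := by
    refine tendsto_sub_mul_partialPairL_of_shift hαT hβT hz' ?_
    rw [hs₀']
    exact hlim
  -- descend from `T` to `S`
  refine exists_ne_zero_tendsto_mul_partialPairL_of_subset hST (hEfin.subset ?_) (fun s => s - s₀)
    ?_ ?_ ⟨c, hc, hTlim⟩
  · rintro w ⟨hwT | hwE, hwS⟩
    · exact absurd hwT hwS
    · exact hwE
  · -- multipliability over `v ∉ T` for `Re s > 1`: (2.1) for `(π₀, σ₀)` after the shift
    filter_upwards [self_mem_nhdsWithin] with s hs
    have hβT' : ∀ w ∉ T, β w = (αP' w).map (((w.residueCard : ℂ) ^ s₂) * ·) :=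
      fun w hw => hβe w (fun h => hw (hST h))
    rw [pairEulerFactor_eq_of_shift hαT hβT' s]
    refine JacquetShalika1981_multipliable_partialPairL_holds P P' (hαP.mono hS₀T) (hαP'.mono hS₀T) ?_
    rw [Complex.sub_re, hz, sub_zero]
    exact hs
  · -- the moved factors are non-zero at `s₀`: strict bound for `π₀`, (5.1.3) for `σ₀`
    rintro w ⟨-, hwS⟩
    have hwS₀ : w ∉ S₀ := fun h => hwS (hS₀S h)
    have hq : w.residueCard ≠ 0 := by have := w.one_lt_residueCard; omega
    rw [hαe w hwS, hβe w hwS, eval_satakePairPolynomial_map_mul_map_mul,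
      natCast_cpow_mul_cpow_mul_cpow_neg _ hq]
    refine eval_satakePairPolynomial_ne_zero_of_lt_sqrt w.one_lt_residueCard
      (fun a ha => norm_lt_sqrt_of_pole_of_eq_conj h23μ hn P hS₀ hαP hwS₀ ha)
      (fun b hb => norm_satakeParameter_le_sqrt_holds P' hαP' hwS₀ hb) ?_
    rw [Complex.sub_re, hz, sub_zero, hs₀]

/-- The rank-wise statements reassemble the named fact: `JacquetShalika1981_partialPairL_pole_repData`
follows from its `L²` form granted rank by rank and field by field (a restatement of
`JacquetShalika1981_partialPairL_pole_repData_of_pole_of_eq_conj` through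
`JacquetShalika1981_partialPairL_pole_repData_rank`). [cite: ArthurClozelAMS120, Ch. 3 §2 (2.3), p. 171] -/
theorem JacquetShalika1981_partialPairL_pole_repData_of_rank
    (h23 : ∀ (n : ℕ) (F : Type) [Field F] [NumberField F]
      (μ : Measure (gl n F).automorphicQuotient) [(gl n F).IsAutomorphicMeasure μ],
      JacquetShalika1981_partialPairL_pole_of_eq_conj (n := n) (K := F) (μ := μ)) :
    JacquetShalika1981_partialPairL_pole_repData :=
  fun n F _ _ hF hn π π' =>
    JacquetShalika1981_partialPairL_pole_repData_rank (fun μ _ => h23 n F μ) hF hn π π'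

/-- **Arthur–Clozel (2.3) for Borel–Jacquet data on `GL_1`, a THEOREM.** For cuspidal automorphic
representations `π`, `σ` of `GL_1(𝔸_F)` in the Borel–Jacquet model (Hecke characters of the idele classes of the
number field `F`, arbitrary — not necessarily unitary — central character) there is a finite `S₀` such
that for every finite `S ⊇ S₀`, all unitary Satake families `α`, `β` of `π`, `σ` off `S`
(`|α_w| = |β_w| = 1`) and every `s₀` with `Re s₀ = 1` and `q_w^{1-s₀} α_w = β_w⁻¹` for almost all `w`
("`π ⊗ | |^{s₀-1} ≅ σ̃`"), the limit `lim_{s → s₀, Re s > 1} (s - s₀) L^S(s, π ⊗ σ)` exists and is finite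
and non-zero: `JacquetShalika1981_partialPairL_pole_repData_rank` in rank `1`, where the `L²` leaf is
the theorem `JacquetShalika1981_partialPairL_pole_of_eq_conj_one` (`L^S(s, Π ⊗ Π̄) = ζ_F^S(s)` has a
simple pole at `1`: Hecke's residue formula for `ζ_F`, proved in the tree). This is the case of
`JacquetShalika1981_partialPairL_pole_repData` consumed at `n = 1` (e.g. `HeckeCharacterPairRigidity`).
[cite: ArthurClozelAMS120, Ch. 3 §2 (2.3), p. 171] [cite: JacquetShalikaAJM1981II, Prop. 3.6] -/
theorem JacquetShalika1981_partialPairL_pole_repData_one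
    {F : Type} [Field F] [NumberField F] (hF : isCompact_glFiniteIntegralLevel 1 F)
    (π π' : CuspidalAutomorphicRepData 1 F hF) :
    ∃ S₀ : Set (HeightOneSpectrum (𝓞 F)), S₀.Finite ∧
      ∀ {S : Set (HeightOneSpectrum (𝓞 F))} (_hS : S.Finite) (_hS₀ : S₀ ⊆ S)
        {α β : SatakeFamily F} (_hα : ∀ w ∉ S, π.1.HasSatakeParamAt w (α w))
        (_hβ : ∀ w ∉ S, π'.1.HasSatakeParamAt w (β w))
        (_hu : ∀ w ∉ S, ‖(α w).prod‖ = 1) (_hu' : ∀ w ∉ S, ‖(β w).prod‖ = 1)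
        {s₀ : ℂ} (_hs₀ : s₀.re = 1)
        (_hX : ∀ᶠ w in cofinite,
          (α w).map (((w.residueCard : ℂ) ^ (1 - s₀)) * ·) = (β w).map (·⁻¹)),
        ∃ c : ℂ, c ≠ 0 ∧
          Tendsto (fun s => (s - s₀) * partialPairL S α β s) (𝓝[{s : ℂ | 1 < s.re}] s₀) (𝓝 c) :=
  JacquetShalika1981_partialPairL_pole_repData_rank
    (fun μ _ => JacquetShalika1981_partialPairL_pole_of_eq_conj_one (K := F) (μ := μ)) hF one_pos π π'

end RankWise

end Literature.NumberTheory.Automorphic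

end
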